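import Literature.NumberTheory.LFunctions.LagariasXiPositivity
import Literature.NumberTheory.LFunctions.RiemannXiLogDeriv
import Literature.NumberTheory.LFunctions.TuringLowerBound
import Literature.Analysis.SpecialFunctions.DigammaGauss
import Literature.NumberTheory.LFunctions.KadiriStechkinFarZeros
import HarnessLib

/-!
# Lagarias 1999, Theorem 1.3 — II: the gamma-factor side (Lemma 3.6 and Theorem 1.2 for `K = ℚ`)

Topic `Literature/NumberTheory/LFunctions`. Pure proof file (nothing is asserted, no definition): the
unconditional part of the proof of `Literature.NumberTheory.LFunctions.Lagarias1999_thm13`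
(`LagariasXiPositivity.lean`; J. C. Lagarias, Acta Arith. 89 (1999), Thm. 1.3), namely the range
`9/2 ≤ σ ≤ 21/2`, `|t| ≥ 21` (Lemma 3.6), where `ξ'(σ)/ξ(σ) ≤ Re ξ'/ξ(σ + it)` holds without any
hypothesis.

The printed proof (§2, (2.13)–(2.23) with `r₁ = 1`, `r₂ = 0`; §3, Lemma 3.6): on `Re s > 1`,
`ξ'/ξ(s) = 1/s + 1/(s−1) − ½ log π + ½ ψ(s/2) − Σ Λ(n) n^{-s}`
(`Literature.NumberTheory.LFunctions.logDeriv_riemannXi_eq_of_one_lt_re`). Comparing `s = σ + it`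
with `σ`: the prime side has `Re Σ Λ(n)n^{-s} ≤ Σ Λ(n)n^{-σ}` ((2.15), nonnegativity of `Λ`;
`Literature.NumberTheory.LFunctions.norm_LSeries_vonMangoldt_le_of_one_lt_re`); by the series
`ψ(w) + γ = Σ_k (1/(k+1) − 1/(w+k))`
(`Literature.Analysis.SpecialFunctions.Complex.hasSum_one_div_sub_one_div_digamma`, (2.16)–(2.17))
`½ Re ψ(s/2) − ½ ψ(σ/2) = Σ_{k ≥ 0} t²/((σ+2k)((σ+2k)² + t²))`, whose `k = 0` term cancels the loss
`1/σ − Re 1/s` at the pole `s = 0`; what remains is the loss `t²/((σ−1)((σ−1)² + t²))` at the pole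
`s = 1` against the gain `Σ_{k ≥ 1} t²/((σ+2k)((σ+2k)²+t²))` ((2.20), (2.22) with `n_K = 1`):

* `re_logDeriv_riemannXi_ofReal_le_of_sum_ge` — the **master inequality**: for `σ > 1`, if
  `1/((σ−1)((σ−1)²+t²)) ≤ Σ_{k=1}^{M} 1/((σ+2k)((σ+2k)²+t²))` then `ξ'(σ)/ξ(σ) ≤ Re ξ'/ξ(σ+it)`.
* `Lagarias1999_lemma36` — **Lemma 3.6**: the hypothesis holds for `9/2 ≤ σ ≤ 21/2`, `|t| ≥ 21`
  with `M = 6` (the ratio of each term to the right side increases with `t²`, so `t = 21` is the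
  worst case; in `σ` we use three pieces of width `2` and crude monotone bounds instead of the
  printed derivative computation), hence `ξ'(σ)/ξ(σ) ≤ Re ξ'/ξ(σ+it)` there. The range `σ ≥ 10`
  (all `t`) is Theorem 1.2 for `K = ℚ`, already in the tree as
  `Literature.NumberTheory.LFunctions.Lagarias1999_thm12_rat_holds` (`LagariasXiPositivityProofs.lean`,
  whose (2.15)/(2.17) lemmas are re-derived here in the shape the master inequality consumes, so
  that this file does not import that one).

## References

* J. C. Lagarias, *On a positivity property of the Riemann ξ-function*, Acta Arith. 89 (1999),
  217–234: §2 (2.13)–(2.23), Thm. 1.2; §3 Lemma 3.6. [LagariasXiPositivity1999]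
* G. E. Andrews, R. Askey, R. Roy, *Special Functions*, CUP 1999, Thm. 1.2.5 (1.2.13).
  [AndrewsAskeyRoy1999]
-/

noncomputable section

open Complex Real LSeries
open scoped LSeries.notation ArithmeticFunction.vonMangoldt

namespace Literature.NumberTheory.LFunctions

namespace Lagarias1999

/-! ### The digamma gain and the prime side

(`Re 1/(x + iy) = x/(x² + y²)` is `Literature.NumberTheory.LFunctions.KadiriStechkin.re_inv_eq`.) -/

/-- **The digamma gain** ((2.16)–(2.17), (2.20)): for `σ > 0` and real `t`,
`Re ψ((σ+it)/2) − ψ(σ/2) = Σ_{k ≥ 0} 2t²/((σ+2k)((σ+2k)²+t²))`, a series of nonnegative terms.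
[cite: LagariasXiPositivity1999, (2.17)] -/
theorem hasSum_re_digamma_half_sub {σ : ℝ} (hσ : 0 < σ) (t : ℝ) :
    HasSum (fun k : ℕ ↦ 2 * t ^ 2 / ((σ + 2 * k) * ((σ + 2 * k) ^ 2 + t ^ 2)))
      ((digamma (((σ : ℂ) + t * I) / 2)).re - (digamma ((σ : ℂ) / 2)).re) := by
  have hw1 : 0 < (((σ : ℂ) + t * I) / 2).re := by simp; positivity
  have hw0 : 0 < ((σ : ℂ) / 2).re := by simp; positivity
  have h1 := Literature.Analysis.SpecialFunctions.Complex.hasSum_one_div_sub_one_div_digamma hw1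
  have h0 := Literature.Analysis.SpecialFunctions.Complex.hasSum_one_div_sub_one_div_digamma hw0
  have h := (h1.sub h0).mapL Complex.reCLM
  simp only [Complex.reCLM_apply] at h
  have hlim : (digamma (((σ : ℂ) + t * I) / 2) + (Real.eulerMascheroniConstant : ℂ) -
      (digamma ((σ : ℂ) / 2) + (Real.eulerMascheroniConstant : ℂ))).re =
      (digamma (((σ : ℂ) + t * I) / 2)).re - (digamma ((σ : ℂ) / 2)).re := by
    simp
  rw [hlim] at h
  refine h.congr_fun fun k ↦ ?_
  have hk : (0 : ℝ) ≤ k := k.cast_nonneg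
  have e1 : ((σ : ℂ) + t * I) / 2 + k = (((σ + 2 * k) / 2 : ℝ) : ℂ) + ((t / 2 : ℝ) : ℂ) * I := by
    push_cast; ring
  have e0 : (σ : ℂ) / 2 + k = (((σ + 2 * k) / 2 : ℝ) : ℂ) + ((0 : ℝ) : ℂ) * I := by
    push_cast; ring
  show 2 * t ^ 2 / ((σ + 2 * k) * ((σ + 2 * k) ^ 2 + t ^ 2)) =
    (1 / ((k : ℂ) + 1) - 1 / (((σ : ℂ) + t * I) / 2 + k) - (1 / ((k : ℂ) + 1) - 1 / ((σ : ℂ) / 2 + k))).re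
  rw [Complex.sub_re, Complex.sub_re, Complex.sub_re, e1, e0, KadiriStechkin.re_inv_eq,
    KadiriStechkin.re_inv_eq]
  have hpos : 0 < σ + 2 * k := by positivity
  field_simp
  ring

/-- **The prime side** ((2.15)): for `σ > 1`, `Re Σ Λ(n) n^{-σ-it} ≤ Σ Λ(n) n^{-σ}`, i.e.
`Re L(Λ, σ + it) ≤ Re L(Λ, σ)` (nonnegativity of `Λ`). [cite: LagariasXiPositivity1999, (2.15)] -/
theorem re_LSeries_vonMangoldt_le {σ : ℝ} (hσ : 1 < σ) (t : ℝ) :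
    (L ↗Λ ((σ : ℂ) + t * I)).re ≤ (L ↗Λ (σ : ℂ)).re := by
  have hs : 1 < ((σ : ℂ) + t * I).re := by simp [hσ]
  have hσ1 : 1 < ((σ : ℂ)).re := by simp [hσ]
  have h := norm_LSeries_vonMangoldt_le_of_one_lt_re hs
  have hre : ((σ : ℂ) + t * I).re = σ := by simp
  rw [hre] at h
  rw [ArithmeticFunction.LSeries_vonMangoldt_eq_deriv_riemannZeta_div hσ1, neg_div]
  rw [neg_div] at h
  exact (Complex.re_le_norm _).trans h

/-! ### The master inequality -/

/-- **Master inequality of §2** (proof of Theorem 1.2, (2.13)–(2.22), for `K = ℚ`): for `σ > 1`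
and real `t`, if the pole at `s = 1` is offset by finitely many poles of the gamma factor,
`1/((σ−1)((σ−1)²+t²)) ≤ Σ_{k=1}^{M} 1/((σ+2k)((σ+2k)²+t²))`, then `ξ'(σ)/ξ(σ) ≤ Re ξ'/ξ(σ+it)`.
[cite: LagariasXiPositivity1999, (2.20)–(2.22)] -/
theorem re_logDeriv_riemannXi_ofReal_le_of_sum_ge {σ t : ℝ} (hσ : 1 < σ) (M : ℕ)
    (h : 1 / ((σ - 1) * ((σ - 1) ^ 2 + t ^ 2)) ≤
      ∑ k ∈ Finset.range M, 1 / ((σ + 2 * (k + 1 : ℕ)) * ((σ + 2 * (k + 1 : ℕ)) ^ 2 + t ^ 2))) :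
    (logDeriv riemannXi (σ : ℂ)).re ≤ (logDeriv riemannXi ((σ : ℂ) + t * I)).re := by
  have hs : 1 < ((σ : ℂ) + t * I).re := by simp [hσ]
  have hσ1 : 1 < ((σ : ℂ)).re := by simp [hσ]
  have E1 := congrArg Complex.re (logDeriv_riemannXi_eq_of_one_lt_re hs)
  have E0 := congrArg Complex.re (logDeriv_riemannXi_eq_of_one_lt_re hσ1)
  -- real parts of the elementary terms
  have hA : ((1 : ℂ) / ((σ : ℂ) + t * I)).re = σ / (σ ^ 2 + t ^ 2) := KadiriStechkin.re_inv_eq σ t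
  have hB : ((1 : ℂ) / ((σ : ℂ) + t * I - 1)).re = (σ - 1) / ((σ - 1) ^ 2 + t ^ 2) := by
    have e : (σ : ℂ) + t * I - 1 = ((σ - 1 : ℝ) : ℂ) + t * I := by push_cast; ring
    rw [e, KadiriStechkin.re_inv_eq]
  have hA0 : ((1 : ℂ) / (σ : ℂ)).re = 1 / σ := by
    rw [← Complex.ofReal_one, ← Complex.ofReal_div, Complex.ofReal_re]
  have hB0 : ((1 : ℂ) / ((σ : ℂ) - 1)).re = 1 / (σ - 1) := by
    have e : (σ : ℂ) - 1 = ((σ - 1 : ℝ) : ℂ) := by push_cast; ring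
    rw [e, ← Complex.ofReal_one, ← Complex.ofReal_div, Complex.ofReal_re]
  have hG : ∀ w : ℂ, (-(Real.log π : ℂ) / 2 + 1 / 2 * digamma w).re =
      -Real.log π / 2 + (digamma w).re / 2 := by
    intro w
    simp only [Complex.add_re, Complex.neg_re, Complex.div_ofNat_re, Complex.ofReal_re,
      Complex.mul_re, Complex.div_ofNat_im, Complex.one_re, Complex.one_im, neg_div]
    ring
  simp only [Complex.add_re, Complex.sub_re, hA, hB, hG] at E1
  simp only [Complex.add_re, Complex.sub_re, hA0, hB0, hG] at E0
  -- the prime side and the digamma gain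
  have hL := re_LSeries_vonMangoldt_le hσ t
  have hD := hasSum_re_digamma_half_sub (by linarith : 0 < σ) t
  have hσ0 : 0 < σ := by linarith
  have hpart := sum_le_hasSum (Finset.range (M + 1))
    (fun k _ ↦ by positivity) hD
  rw [Finset.sum_range_succ'] at hpart
  simp only [Nat.cast_add, Nat.cast_one, CharP.cast_eq_zero, mul_zero, add_zero] at hpart
  -- the terms `k = 1, …, M` of the gain dominate the loss at the pole `s = 1`
  have hgain : t ^ 2 * (1 / ((σ - 1) * ((σ - 1) ^ 2 + t ^ 2))) ≤
      t ^ 2 * ∑ k ∈ Finset.range M,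
        1 / ((σ + 2 * (k + 1 : ℕ)) * ((σ + 2 * (k + 1 : ℕ)) ^ 2 + t ^ 2)) :=
    mul_le_mul_of_nonneg_left h (sq_nonneg t)
  rw [Finset.mul_sum] at hgain
  have hsumeq : ∑ k ∈ Finset.range M,
      t ^ 2 * (1 / ((σ + 2 * (k + 1 : ℕ)) * ((σ + 2 * (k + 1 : ℕ)) ^ 2 + t ^ 2))) =
      (∑ k ∈ Finset.range M,
        2 * t ^ 2 / ((σ + 2 * ((k : ℝ) + 1)) * ((σ + 2 * ((k : ℝ) + 1)) ^ 2 + t ^ 2))) / 2 := by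
    rw [Finset.sum_div]
    refine Finset.sum_congr rfl fun k _ ↦ ?_
    push_cast
    ring
  rw [hsumeq] at hgain
  -- the losses at the two poles
  have hσ1' : 0 < σ - 1 := by linarith
  have hl0 : σ / (σ ^ 2 + t ^ 2) - 1 / σ = -(t ^ 2 / (σ * (σ ^ 2 + t ^ 2))) := by
    field_simp; ring
  have hl1 : (σ - 1) / ((σ - 1) ^ 2 + t ^ 2) - 1 / (σ - 1) =
      -(t ^ 2 * (1 / ((σ - 1) * ((σ - 1) ^ 2 + t ^ 2)))) := by
    field_simp; ring
  have hk0 : 2 * t ^ 2 / (σ * (σ ^ 2 + t ^ 2)) = 2 * (t ^ 2 / (σ * (σ ^ 2 + t ^ 2))) := by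
    ring
  rw [E1, E0]
  linarith [hl0, hl1, hk0, hpart, hgain, hL]

/-! ### Lemma 3.6: `σ ≥ 9/2`, `|t| ≥ 21` -/

/-- **The ratio trick of Lemma 3.6**: for `1 < σ`, `σ − 1 ≤ c` and `441 ≤ t²`,
`[(σ−1)((σ−1)²+441)/(c(c²+441))] · 1/((σ−1)((σ−1)²+t²)) ≤ 1/(c(c²+t²))`
(the ratio of the two sides increases with `t²`). [cite: LagariasXiPositivity1999, Lemma 3.6 (proof)] -/
theorem ratio_mul_le {σ c t : ℝ} (hσ : 1 < σ) (hc : σ - 1 ≤ c) (ht : 441 ≤ t ^ 2) :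
    (σ - 1) * ((σ - 1) ^ 2 + 441) / (c * (c ^ 2 + 441)) * (1 / ((σ - 1) * ((σ - 1) ^ 2 + t ^ 2))) ≤
      1 / (c * (c ^ 2 + t ^ 2)) := by
  have hσ1 : 0 < σ - 1 := by linarith
  have hc0 : 0 < c := by linarith
  rw [div_mul_div_comm, mul_one, div_le_div_iff₀ (by positivity) (by positivity), one_mul]
  have hsq : (σ - 1) ^ 2 ≤ c ^ 2 := pow_le_pow_left₀ hσ1.le hc 2
  have key : ((σ - 1) ^ 2 + 441) * (c ^ 2 + t ^ 2) ≤ (c ^ 2 + 441) * ((σ - 1) ^ 2 + t ^ 2) := by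
    nlinarith
  have := mul_le_mul_of_nonneg_left key (by positivity : (0 : ℝ) ≤ (σ - 1) * c)
  nlinarith [this]

/-- **Lemma 3.6, the sum on a `σ`-piece**: if `1 < a ≤ σ ≤ b` and `441 ≤ t²`, then
`[(a−1)((a−1)²+441) · Σ_{k=1}^{M} 1/((b+2k)((b+2k)²+441))] / ((σ−1)((σ−1)²+t²))
≤ Σ_{k=1}^{M} 1/((σ+2k)((σ+2k)²+t²))`. [cite: LagariasXiPositivity1999, Lemma 3.6 (proof)] -/
theorem piece_sum_le {a b σ t : ℝ} (ha : 1 < a) (haσ : a ≤ σ) (hσb : σ ≤ b) (ht : 441 ≤ t ^ 2)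
    (M : ℕ) :
    (a - 1) * ((a - 1) ^ 2 + 441) *
        (∑ k ∈ Finset.range M, 1 / ((b + 2 * (k + 1 : ℕ)) * ((b + 2 * (k + 1 : ℕ)) ^ 2 + 441))) *
        (1 / ((σ - 1) * ((σ - 1) ^ 2 + t ^ 2))) ≤
      ∑ k ∈ Finset.range M, 1 / ((σ + 2 * (k + 1 : ℕ)) * ((σ + 2 * (k + 1 : ℕ)) ^ 2 + t ^ 2)) := by
  rw [Finset.mul_sum, Finset.sum_mul]
  refine Finset.sum_le_sum fun k _ ↦ ?_
  have hσ : 1 < σ := by linarith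
  have hk : (0 : ℝ) ≤ k := k.cast_nonneg
  set c : ℝ := σ + 2 * (k + 1 : ℕ) with hc
  have hcσ : σ - 1 ≤ c := by rw [hc]; push_cast; linarith
  have h1 := ratio_mul_le hσ hcσ ht
  -- monotonicity in `σ` of numerator and denominator of the ratio
  have hnum : (a - 1) * ((a - 1) ^ 2 + 441) ≤ (σ - 1) * ((σ - 1) ^ 2 + 441) := by
    have h2 : (a - 1) ^ 2 ≤ (σ - 1) ^ 2 := pow_le_pow_left₀ (by linarith) (by linarith) 2
    exact mul_le_mul (by linarith) (by linarith) (by positivity) (by linarith)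
  have hden : c * (c ^ 2 + 441) ≤ (b + 2 * (k + 1 : ℕ)) * ((b + 2 * (k + 1 : ℕ)) ^ 2 + 441) := by
    have hcb : c ≤ b + 2 * (k + 1 : ℕ) := by rw [hc]; linarith
    have hc0 : 0 ≤ c := by rw [hc]; push_cast; linarith
    have h2 : c ^ 2 ≤ (b + 2 * (k + 1 : ℕ)) ^ 2 := pow_le_pow_left₀ hc0 hcb 2
    exact mul_le_mul hcb (by linarith) (by positivity) (hc0.trans hcb)
  have hc0 : 0 < c := by rw [hc]; push_cast; linarith
  have hR : 0 ≤ 1 / ((σ - 1) * ((σ - 1) ^ 2 + t ^ 2)) := by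
    have : 0 < σ - 1 := by linarith
    positivity
  calc (a - 1) * ((a - 1) ^ 2 + 441) * (1 / ((b + 2 * (k + 1 : ℕ)) * ((b + 2 * (k + 1 : ℕ)) ^ 2 + 441)))
        * (1 / ((σ - 1) * ((σ - 1) ^ 2 + t ^ 2)))
      ≤ (σ - 1) * ((σ - 1) ^ 2 + 441) / (c * (c ^ 2 + 441)) *
          (1 / ((σ - 1) * ((σ - 1) ^ 2 + t ^ 2))) := by
        apply mul_le_mul_of_nonneg_right _ hR
        rw [mul_one_div]
        have ha1 : 0 ≤ (a - 1) * ((a - 1) ^ 2 + 441) := by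
          have : 0 < a - 1 := by linarith
          positivity
        calc (a - 1) * ((a - 1) ^ 2 + 441) / ((b + 2 * (k + 1 : ℕ)) * ((b + 2 * (k + 1 : ℕ)) ^ 2 + 441))
            ≤ (a - 1) * ((a - 1) ^ 2 + 441) / (c * (c ^ 2 + 441)) :=
              div_le_div_of_nonneg_left ha1 (by positivity) hden
          _ ≤ (σ - 1) * ((σ - 1) ^ 2 + 441) / (c * (c ^ 2 + 441)) :=
              div_le_div_of_nonneg_right hnum (by positivity)
    _ ≤ 1 / (c * (c ^ 2 + t ^ 2)) := h1

/-- **Lemma 3.6, the hypothesis of the master inequality**: for `9/2 ≤ σ ≤ 21/2` and `441 ≤ t²`,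
`1/((σ−1)((σ−1)²+t²)) ≤ Σ_{k=1}^{6} 1/((σ+2k)((σ+2k)²+t²))` (three pieces `[9/2,13/2]`,
`[13/2,17/2]`, `[17/2,21/2]`, on each of which the crude constant of `piece_sum_le` is `> 1`:
`1.26…`, `1.61…`, `1.85…`; Lagarias: at `σ = 9/2`, `t = 21` "the sum of the ratios for the first
three terms already exceeds one"). [cite: LagariasXiPositivity1999, Lemma 3.6] -/
theorem sum_ge_of_mem_Icc {σ t : ℝ} (hσ : 9 / 2 ≤ σ) (hσ' : σ ≤ 21 / 2) (ht : 441 ≤ t ^ 2) :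
    1 / ((σ - 1) * ((σ - 1) ^ 2 + t ^ 2)) ≤
      ∑ k ∈ Finset.range 6, 1 / ((σ + 2 * (k + 1 : ℕ)) * ((σ + 2 * (k + 1 : ℕ)) ^ 2 + t ^ 2)) := by
  have hR : 0 ≤ 1 / ((σ - 1) * ((σ - 1) ^ 2 + t ^ 2)) := by
    have : 0 < σ - 1 := by linarith
    positivity
  rcases le_or_gt σ (13 / 2) with h1 | h1
  · have h := piece_sum_le (a := 9 / 2) (b := 13 / 2) (by norm_num) hσ h1 ht 6
    have hc : (1 : ℝ) ≤ (9 / 2 - 1) * ((9 / 2 - 1) ^ 2 + 441) *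
        ∑ k ∈ Finset.range 6,
          1 / (((13 / 2 : ℝ) + 2 * ((k + 1 : ℕ) : ℝ)) * (((13 / 2 : ℝ) + 2 * ((k + 1 : ℕ) : ℝ)) ^ 2 + 441)) := by
      simp only [Finset.sum_range_succ, Finset.sum_range_zero]
      norm_num
    have hcR := mul_le_mul_of_nonneg_right hc hR
    linarith
  rcases le_or_gt σ (17 / 2) with h2 | h2
  · have h := piece_sum_le (a := 13 / 2) (b := 17 / 2) (by norm_num) h1.le h2 ht 6
    have hc : (1 : ℝ) ≤ (13 / 2 - 1) * ((13 / 2 - 1) ^ 2 + 441) *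
        ∑ k ∈ Finset.range 6,
          1 / (((17 / 2 : ℝ) + 2 * ((k + 1 : ℕ) : ℝ)) * (((17 / 2 : ℝ) + 2 * ((k + 1 : ℕ) : ℝ)) ^ 2 + 441)) := by
      simp only [Finset.sum_range_succ, Finset.sum_range_zero]
      norm_num
    have hcR := mul_le_mul_of_nonneg_right hc hR
    linarith
  · have h := piece_sum_le (a := 17 / 2) (b := 21 / 2) (by norm_num) h2.le hσ' ht 6
    have hc : (1 : ℝ) ≤ (17 / 2 - 1) * ((17 / 2 - 1) ^ 2 + 441) *
        ∑ k ∈ Finset.range 6,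
          1 / (((21 / 2 : ℝ) + 2 * ((k + 1 : ℕ) : ℝ)) * (((21 / 2 : ℝ) + 2 * ((k + 1 : ℕ) : ℝ)) ^ 2 + 441)) := by
      simp only [Finset.sum_range_succ, Finset.sum_range_zero]
      norm_num
    have hcR := mul_le_mul_of_nonneg_right hc hR
    linarith

/-- **Lemma 3.6 (unconditional)**, in the range `9/2 ≤ σ ≤ 21/2`, `|t| ≥ 21`:
`ξ'(σ)/ξ(σ) ≤ Re ξ'/ξ(σ + it)` (the printed statement has `>` and all `σ ≥ 9/2`; the range
`σ ≥ 10` is Theorem 1.2, `Literature.NumberTheory.LFunctions.Lagarias1999_thm12_rat_holds` of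
`LagariasXiPositivityProofs.lean`). [cite: LagariasXiPositivity1999, Lemma 3.6] -/
theorem Lagarias1999_lemma36 {σ t : ℝ} (hσ : 9 / 2 ≤ σ) (hσ' : σ ≤ 21 / 2) (ht : 21 ≤ |t|) :
    (logDeriv riemannXi (σ : ℂ)).re ≤ (logDeriv riemannXi ((σ : ℂ) + t * I)).re := by
  have ht2 : 441 ≤ t ^ 2 := by
    have h21 : (21 : ℝ) ^ 2 ≤ |t| ^ 2 := pow_le_pow_left₀ (by norm_num) ht 2
    rw [sq_abs] at h21; linarith
  exact re_logDeriv_riemannXi_ofReal_le_of_sum_ge (by linarith) 6 (sum_ge_of_mem_Icc hσ hσ' ht2)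

end Lagarias1999

end Literature.NumberTheory.LFunctions

end
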